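import Literature.NumberTheory.ModularForms.Lemma49Plus24
import HarnessLib

/-!
# CKMRV Lemma 4.9 (4.16) for `𝒦₊^{(24)}`: the non-decaying part `𝒢₊^{(24)}` and the bound

Cohn–Kumar–Miller–Radchenko–Viazovska, arXiv:1902.05438, §4.4 (definition of `𝒢^{(d)}_±` as the sum of
the `e^{nπiz}`, `n ≤ 0`, terms of the expansion of `𝒦^{(d)}_±(τ,z)` in powers of `e^{πiz}`;
`𝒢^{(d)}_±(τ,z) = Σ_{k=−1}^{0} Σ_{j=0}^{1} z^j e^{2πikz}𝒢^{(d)}_{k,j,±}(τ)`) and Lemma 4.9 (4.16) with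
`n_{+,z} = 2`: `|((𝒦₊^{(24)} − 𝒢₊^{(24)})|^τ_{12}γ)(τ,z)| ≤ C|e^{2πiz}τ²z²/(Δ(τ)Δ(z)(j(τ)−j(z)))|`.

For rows `R = (R₋₂,R₀,R₂)` the numerator `N_R = plus24Kernel R·Δ(τ)Δ(z)(j(τ)−j(z)) = c·Σᵢ fᵢ(τ)Kᵢ(z)`
with the seven `τ`-functions of `Lemma49Plus24` and `Kᵢ` built from `h₁ = E₄z², h₂ = jE₄z²,
h₃ = φ̃₂, h₄ = jφ̃₂, h₅ = (E₁₄/Δ)φ̃₀`, whose principal parts in `y = e^{2πiz}` are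
`z², z²/y + 984z², (z−6i/π)², (z−6i/π)²/y + 744(z−6i/π)² − 48z(z−6i/π), (z²−6iz/π)/y − 24z²`.
Solving for the principal part of `𝒦 = N/(ΔΔ(j−j))` gives the explicit
**`𝒢_R = c·(Ĝ₋₁(τ,z)e^{−2πiz} + Ĝ₀(τ,z))`** (`plus24G`; `Ĝ₋₁, Ĝ₀` polynomials in the rows,
`E₄(τ), E₆(τ), Δ(τ)` and of degree `1` in `z`, as asserted in §4.4). PROVED: the multiplied-out
identity `(plus24Kernel R − 𝒢_R)·ΔΔ(j−j) = c·M_R` with `M_R` an explicit sum of products each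
carrying a factor vanishing to order `e^{2πiz}` (`plus24Kernel_sub_G_mul_eq`), the uniform bounds for
those factors, and **(4.16) for rows `O(|τ|²)`**, hence for `γ = I, T, TS` (`kernelPlus24_sub_G_bound_416`).

## References

* H. Cohn, A. Kumar, S. D. Miller, D. Radchenko, M. Viazovska, Ann. of Math. 196 (2022),
  arXiv:1902.05438, §4.4, Lemma 4.9 (4.16). [CohnEtAl2019]
-/

noncomputable section

open Complex hiding I
open Filter Topology Asymptotics ModularForm SlashInvariantForm EisensteinSeries
open UpperHalfPlane hiding I
open Complex (I)
open scoped Real MatrixGroups ModularForm Manifold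

namespace Literature.NumberTheory.ModularForms

open Literature.NumberTheory.EllipticCurves.ModularForms (kleinJ kleinJ_smul continuous_kleinJ E₄_cube_eq_kleinJ_mul)

/-! ## The untwisted `z`-functions, their principal parts, and `𝒢₊^{(24)}` -/

/-- `K₁ = 6(h₁ − h₃)`. [cite: CohnEtAl2019, Lemma 4.9 (proof)] -/
def K24a (z : ℍ) : ℂ := 6 * (E₄ z * (z : ℂ) ^ 2 - phiTilde2 z)
/-- `K₂ = 𝔠h₃ + 6(h₄ − h₂)`. [cite: CohnEtAl2019, Lemma 4.9 (proof)] -/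
def K24b (z : ℍ) : ℂ := 1728 * phiTilde2 z + 6 * (kleinJ z * phiTilde2 z - kleinJ z * E₄ z * (z : ℂ) ^ 2)
/-- `K₄ = 5𝔠h₁ − 7𝔠h₃ + 12(h₂ − h₄)`. [cite: CohnEtAl2019, Lemma 4.9 (proof)] -/
def K24d (z : ℍ) : ℂ :=
  5 * 1728 * (E₄ z * (z : ℂ) ^ 2) - 7 * 1728 * phiTilde2 z + 12 * (kleinJ z * E₄ z * (z : ℂ) ^ 2 - kleinJ z * phiTilde2 z)
/-- `K₅ = 𝔠(−5h₂ − 2h₅ + 7h₄)`. [cite: CohnEtAl2019, Lemma 4.9 (proof)] -/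
def K24e (z : ℍ) : ℂ :=
  1728 * (-5 * (kleinJ z * E₄ z * (z : ℂ) ^ 2) - 2 * (f2fun z * phiTilde0 z) + 7 * (kleinJ z * phiTilde2 z))
/-- `K₇ = 𝔠h₁ + 6(h₄ − h₂)`. [cite: CohnEtAl2019, Lemma 4.9 (proof)] -/
def K24g (z : ℍ) : ℂ := 1728 * (E₄ z * (z : ℂ) ^ 2) + 6 * (kleinJ z * phiTilde2 z - kleinJ z * E₄ z * (z : ℂ) ^ 2)

/-- Principal parts of `h₁, …, h₅` (polynomials in `z` and `e^{−2πiz} = (qfun z)⁻¹`). [cite: CohnEtAl2019, Lemma 4.9 (proof)] -/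
def Qh24a (z : ℍ) : ℂ := (z : ℂ) ^ 2
/-- `Qh24b` (auxiliary). [cite: CohnEtAl2019, Lemma 4.9 (proof)] -/
def Qh24b (z : ℍ) : ℂ := (z : ℂ) ^ 2 * (qfun z)⁻¹ + 984 * (z : ℂ) ^ 2
/-- `Qh24c` (auxiliary). [cite: CohnEtAl2019, Lemma 4.9 (proof)] -/
def Qh24c (z : ℍ) : ℂ := ((z : ℂ) - 6 * I / π) ^ 2
/-- `Qh24d` (auxiliary). [cite: CohnEtAl2019, Lemma 4.9 (proof)] -/
def Qh24d (z : ℍ) : ℂ := ((z : ℂ) - 6 * I / π) ^ 2 * (qfun z)⁻¹ + 744 * ((z : ℂ) - 6 * I / π) ^ 2 - 48 * z * ((z : ℂ) - 6 * I / π)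
/-- `Qh24e` (auxiliary). [cite: CohnEtAl2019, Lemma 4.9 (proof)] -/
def Qh24e (z : ℍ) : ℂ := ((z : ℂ) ^ 2 - 6 * I * z / π) * (qfun z)⁻¹ - 24 * (z : ℂ) ^ 2

/-- Principal parts of `K₁,…,K₇`. [cite: CohnEtAl2019, Lemma 4.9 (proof)] -/
def QK24a (z : ℍ) : ℂ := 6 * (Qh24a z - Qh24c z)
/-- `QK24b` (auxiliary). [cite: CohnEtAl2019, Lemma 4.9 (proof)] -/
def QK24b (z : ℍ) : ℂ := 1728 * Qh24c z + 6 * (Qh24d z - Qh24b z)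
/-- `QK24d` (auxiliary). [cite: CohnEtAl2019, Lemma 4.9 (proof)] -/
def QK24d (z : ℍ) : ℂ := 5 * 1728 * Qh24a z - 7 * 1728 * Qh24c z + 12 * (Qh24b z - Qh24d z)
/-- `QK24e` (auxiliary). [cite: CohnEtAl2019, Lemma 4.9 (proof)] -/
def QK24e (z : ℍ) : ℂ := 1728 * (-5 * Qh24b z - 2 * Qh24e z + 7 * Qh24d z)
/-- `QK24g` (auxiliary). [cite: CohnEtAl2019, Lemma 4.9 (proof)] -/
def QK24g (z : ℍ) : ℂ := 1728 * Qh24a z + 6 * (Qh24d z - Qh24b z)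

/-- `Ĝ₋₁(τ,z)` (coefficient of `e^{−2πiz}`), of degree `1` in `z`. [cite: CohnEtAl2019, §4.4] -/
def plus24GhatM1 (Rm R0 R2 : ℍ → ℂ) (τ z : ℍ) : ℂ :=
  72 * (I / π) * (Rm τ * E₄ τ ^ 2 * E₆ τ - 2 * R0 τ * E₄ τ ^ 3 + R2 τ * E₄ τ * E₆ τ) * ((z : ℂ) - 3 * (I / π))
  + R0 τ * ModularForm.discriminant τ * (124416 * (I / π) * z - 435456 * (I / π) ^ 2)

/-- `Ĝ₀(τ,z)`, of degree `1` in `z`. [cite: CohnEtAl2019, §4.4] -/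
def plus24Ghat0 (Rm R0 R2 : ℍ → ℂ) (τ z : ℍ) : ℂ :=
  20736 * (I / π) * (Rm τ * E₄ τ ^ 2 * E₆ τ) * z - 67392 * (I / π) ^ 2 * (Rm τ * E₄ τ ^ 2 * E₆ τ)
  - 20736 * (I / π) * (R0 τ * E₄ τ ^ 3) * z + 10368 * (I / π) ^ 2 * (R0 τ * E₄ τ ^ 3)
  + 14929920 * (I / π) * (R0 τ * ModularForm.discriminant τ) * z - 10450944 * (I / π) ^ 2 * (R0 τ * ModularForm.discriminant τ)
  - 5184 * (I / π) ^ 2 * (R2 τ * E₄ τ * E₆ τ)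

/-- **`𝒢_R = c·(Ĝ₋₁e^{−2πiz} + Ĝ₀)`** (`𝒢₊^{(24)} = plus24G φ₋₂ φ₀ φ₂`). [cite: CohnEtAl2019, §4.4] -/
def plus24G (Rm R0 R2 : ℍ → ℂ) (τ z : ℍ) : ℂ :=
  (π : ℂ) ^ 2 / (36 * 1728 * I) * (plus24GhatM1 Rm R0 R2 τ z * (qfun z)⁻¹ + plus24Ghat0 Rm R0 R2 τ z)

/-- The explicit remainder `M_R`: every term carries a `z`-factor vanishing to order `e^{2πiz}`.
[cite: CohnEtAl2019, Lemma 4.9 (proof)] -/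
def plus24M (Rm R0 R2 : ℍ → ℂ) (τ z : ℍ) : ℂ :=
  Rm τ * E14fun τ * E₄ τ ^ 3 * (K24a z - QK24a z) + Rm τ * E14fun τ * ModularForm.discriminant τ * (K24b z - QK24b z)
  + R0 τ * E₄ τ ^ 6 * (-2 * (K24a z - QK24a z)) + R0 τ * E₄ τ ^ 3 * ModularForm.discriminant τ * (K24d z - QK24d z)
  + R0 τ * ModularForm.discriminant τ ^ 2 * (K24e z - QK24e z)
  + R2 τ * E10fun τ * E₄ τ ^ 3 * (K24a z - QK24a z) + R2 τ * E10fun τ * ModularForm.discriminant τ * (K24g z - QK24g z)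
  - ( plus24GhatM1 Rm R0 R2 τ z * E₄ τ ^ 3 * (ModularForm.discriminant z * (qfun z)⁻¹ - 1)
      + plus24Ghat0 Rm R0 R2 τ z * E₄ τ ^ 3 * ModularForm.discriminant z
      - plus24GhatM1 Rm R0 R2 τ z * ModularForm.discriminant τ * (E₄ z ^ 3 * (qfun z)⁻¹ - (qfun z)⁻¹ - 720)
      - plus24Ghat0 Rm R0 R2 τ z * ModularForm.discriminant τ * (E₄ z ^ 3 - 1) )

/-- **The multiplied-out identity** `(plus24Kernel R − 𝒢_R)·Δ(τ)Δ(z)(j(τ)−j(z)) = c·M_R` off the poles.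
[cite: CohnEtAl2019, Lemma 4.9 (proof)] -/
theorem plus24Kernel_sub_G_mul_eq (Rm R0 R2 : ℍ → ℂ) (τ z : ℍ) (hJ : kleinJ τ - kleinJ z ≠ 0) :
    (plus24Kernel Rm R0 R2 τ z - plus24G Rm R0 R2 τ z) *
      (ModularForm.discriminant τ * ModularForm.discriminant z * (kleinJ τ - kleinJ z)) =
        (π : ℂ) ^ 2 / (36 * 1728 * I) * plus24M Rm R0 R2 τ z := by
  have hΔz := ModularForm.discriminant_ne_zero z
  have hΔτ := ModularForm.discriminant_ne_zero τ
  have hq := qfun_ne_zero z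
  have hI : (36 * 1728 * I : ℂ) ≠ 0 := by simp [I_ne_zero]
  have hπ : (π : ℂ) ≠ 0 := ofReal_ne_zero.2 Real.pi_ne_zero
  have e1 : kleinJ τ = E₄ τ ^ 3 / ModularForm.discriminant τ := by rw [eq_div_iff hΔτ]; exact (E₄_cube_eq_kleinJ_mul τ).symm
  have e2 : kleinJ z = E₄ z ^ 3 / ModularForm.discriminant z := by rw [eq_div_iff hΔz]; exact (E₄_cube_eq_kleinJ_mul z).symm
  simp only [plus24Kernel, plus24G, plus24M, plus24GhatM1, plus24Ghat0, K24a, K24b, K24d, K24e, K24g,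
    QK24a, QK24b, QK24d, QK24e, QK24g, Qh24a, Qh24b, Qh24c, Qh24d, Qh24e, phiTildeNeg2, E14fun, E10fun, Pi.mul_apply]
  field_simp
  rw [e1, e2]
  field_simp
  ring

/-- `norm_plus24Kernel_sub_G_mul_le` (auxiliary). [cite: CohnEtAl2019, Lemma 4.9 (proof)] -/
theorem norm_plus24Kernel_sub_G_mul_le (Rm R0 R2 : ℍ → ℂ) (τ z : ℍ) :
    ‖(plus24Kernel Rm R0 R2 τ z - plus24G Rm R0 R2 τ z) *
      (ModularForm.discriminant τ * ModularForm.discriminant z * (kleinJ τ - kleinJ z))‖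
        ≤ ‖(π : ℂ) ^ 2 / (36 * 1728 * I)‖ * ‖plus24M Rm R0 R2 τ z‖ := by
  by_cases hJ : kleinJ τ - kleinJ z = 0
  · rw [hJ]; simp; positivity
  · rw [plus24Kernel_sub_G_mul_eq Rm R0 R2 τ z hJ, norm_mul]

/-! ## The scalar `1`-periodic remainders are `O(e^{−2π Im z})` -/

/-- `continuous_qfun_inv` (auxiliary). [cite: CohnEtAl2019, Lemma 4.9 (proof)] -/
@[fun_prop] theorem continuous_qfun_inv : Continuous fun z : ℍ => (qfun z)⁻¹ :=
  Continuous.inv₀ (by unfold qfun; fun_prop) qfun_ne_zero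

/-- `qfun_inv_vadd_two` (auxiliary). [cite: CohnEtAl2019, Lemma 4.9 (proof)] -/
theorem qfun_inv_vadd_two (τ : ℍ) : (qfun ((2 : ℝ) +ᵥ τ))⁻¹ = (qfun τ)⁻¹ := by rw [qfun_vadd_two]

/-- At `i∞`: `jE₄ − 1/q − 984`, `jE₂² − 1/q − 696`, `jE₂ − 1/q − 720`, `j − 1/q − 744`, `(E₁₄/Δ)E₂ − 1/q + 24`,
`E₁₄/Δ − 1/q`, `Δ/q − 1`, `E₄³/q − 1/q − 720` are `O(q)`. [cite: CohnEtAl2019, §2.1, §4.4] -/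
theorem scalar24_isBigO_atImInfty :
    ((fun z : ℍ => kleinJ z * E₄ z - (qfun z)⁻¹ - 984) =O[atImInfty] expDecay) ∧
    ((fun z : ℍ => kleinJ z * E2 z ^ 2 - (qfun z)⁻¹ - 696) =O[atImInfty] expDecay) ∧
    ((fun z : ℍ => kleinJ z * E2 z - (qfun z)⁻¹ - 720) =O[atImInfty] expDecay) ∧
    ((fun z : ℍ => kleinJ z - (qfun z)⁻¹ - 744) =O[atImInfty] expDecay) ∧
    ((fun z : ℍ => f2fun z * E2 z - (qfun z)⁻¹ + 24) =O[atImInfty] expDecay) ∧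
    ((fun z : ℍ => f2fun z - (qfun z)⁻¹) =O[atImInfty] expDecay) ∧
    ((fun z : ℍ => ModularForm.discriminant z * (qfun z)⁻¹ - 1) =O[atImInfty] expDecay) ∧
    ((fun z : ℍ => E₄ z ^ 3 * (qfun z)⁻¹ - (qfun z)⁻¹ - 720) =O[atImInfty] expDecay) := by
  have hq : (fun τ => qfun τ) =O[atImInfty] expDecay := qfun_isBigO
  have h2 := E2_second_order
  have h4 := E₄_second_order
  have hj := kleinJ_mul_q_second_order
  have hf := qfun_mul_f2fun_second_order
  have hΔ2 := discriminant_second_order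
  obtain ⟨_, h43, _⟩ := E14_E4cube_E10_second_order
  have h21 : (fun τ : ℍ => E2 τ - 1) =O[atImInfty] expDecay := E2_sub_one_isBigO
  have h41 : (fun τ : ℍ => E₄ τ - 1) =O[atImInfty] expDecay := E₄_sub_one_isBigO
  have one1 : (fun _ : ℍ => (1 : ℂ)) =O[atImInfty] fun _ : ℍ => (1 : ℝ) := isBigO_const_const (1 : ℂ) (one_ne_zero : (1:ℝ) ≠ 0) _
  have hE2b : E2 =O[atImInfty] fun _ : ℍ => (1 : ℝ) := by
    have := (h21.trans expDecay_isBigO_one').add one1; simpa using this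
  have hE4b : (⇑E₄ : ℍ → ℂ) =O[atImInfty] fun _ : ℍ => (1 : ℝ) := by
    have := (h41.trans expDecay_isBigO_one').add one1; simpa using this
  have hE22b : (fun τ : ℍ => E2 τ ^ 2) =O[atImInfty] fun _ : ℍ => (1 : ℝ) := by simpa [sq] using hE2b.mul hE2b
  have fin : ∀ {s : ℍ → ℂ}, (fun z => qfun z * s z) =O[atImInfty] (fun z => expDecay z ^ 2) → s =O[atImInfty] expDecay :=
    fun h => (isBigO_of_qfun_mul (m := 1) h).congr_right fun z => pow_one _
  -- generic pieces `q·(E − 1)·c`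
  have qE4 : ∀ c : ℂ, (fun τ : ℍ => c * qfun τ * (E₄ τ - 1)) =O[atImInfty] fun τ => expDecay τ ^ 2 := fun c => by
    have := (hq.mul h41).const_mul_left c
    exact (this.congr_left fun τ => by ring).congr_right fun τ => by ring
  have qE2 : ∀ c : ℂ, (fun τ : ℍ => c * qfun τ * (E2 τ - 1)) =O[atImInfty] fun τ => expDecay τ ^ 2 := fun c => by
    have := (hq.mul h21).const_mul_left c
    exact (this.congr_left fun τ => by ring).congr_right fun τ => by ring
  have hE22 : (fun τ : ℍ => E2 τ ^ 2 - 1 + 48 * qfun τ) =O[atImInfty] fun τ => expDecay τ ^ 2 := by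
    have t1 : (fun τ : ℍ => (E2 τ - 1 + 24 * qfun τ) * (E2 τ + 1)) =O[atImInfty] fun τ => expDecay τ ^ 2 := by
      simpa using h2.mul (hE2b.add one1)
    exact (t1.sub (qE2 24)).congr_left fun τ => by ring
  refine ⟨fin ?_, fin ?_, fin ?_, fin ?_, fin ?_, fin ?_, fin ?_, fin ?_⟩
  · have t1 : (fun z : ℍ => (qfun z * kleinJ z - 1 - 744 * qfun z) * E₄ z) =O[atImInfty] fun z => expDecay z ^ 2 := by
      simpa using hj.mul hE4b
    have := (t1.add h4).add (qE4 744)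
    refine this.congr_left fun z => ?_
    have hqz := qfun_ne_zero z
    field_simp
    ring
  · have t1 : (fun z : ℍ => (qfun z * kleinJ z - 1 - 744 * qfun z) * E2 z ^ 2) =O[atImInfty] fun z => expDecay z ^ 2 := by
      simpa using hj.mul hE22b
    have t3 : (fun τ : ℍ => 744 * qfun τ * ((E2 τ - 1) * (E2 τ + 1))) =O[atImInfty] fun τ => expDecay τ ^ 2 := by
      have := (hq.mul (h21.mul (hE2b.add one1))).const_mul_left 744
      exact (this.congr_left fun τ => by ring).congr_right fun τ => by ring
    have := (t1.add hE22).add t3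
    refine this.congr_left fun z => ?_
    have hqz := qfun_ne_zero z
    field_simp
    ring
  · have t1 : (fun z : ℍ => (qfun z * kleinJ z - 1 - 744 * qfun z) * E2 z) =O[atImInfty] fun z => expDecay z ^ 2 := by
      simpa using hj.mul hE2b
    have := (t1.add h2).add (qE2 744)
    refine this.congr_left fun z => ?_
    have hqz := qfun_ne_zero z
    field_simp
    ring
  · refine hj.congr_left fun z => ?_
    have hqz := qfun_ne_zero z
    field_simp
  · have t1 : (fun z : ℍ => (qfun z * f2fun z - 1) * E2 z) =O[atImInfty] fun z => expDecay z ^ 2 := by simpa using hf.mul hE2b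
    have := t1.add h2
    refine this.congr_left fun z => ?_
    have hqz := qfun_ne_zero z
    field_simp
    ring
  · refine hf.congr_left fun z => ?_
    have hqz := qfun_ne_zero z
    field_simp
  · refine hΔ2.congr_left fun z => ?_
    have hqz := qfun_ne_zero z
    field_simp
  · refine h43.congr_left fun z => ?_
    have hqz := qfun_ne_zero z
    field_simp

/-- The same on half-planes. [cite: CohnEtAl2019, Lemma 4.9 (proof)] -/
theorem scalar24_isBigO_halfPlane {δ : ℝ} (hδ : 0 < δ) :
    ((fun z : ℍ => kleinJ z * E₄ z - (qfun z)⁻¹ - 984) =O[𝓟 (halfPlane δ)] expDecay) ∧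
    ((fun z : ℍ => kleinJ z * E2 z ^ 2 - (qfun z)⁻¹ - 696) =O[𝓟 (halfPlane δ)] expDecay) ∧
    ((fun z : ℍ => kleinJ z * E2 z - (qfun z)⁻¹ - 720) =O[𝓟 (halfPlane δ)] expDecay) ∧
    ((fun z : ℍ => kleinJ z - (qfun z)⁻¹ - 744) =O[𝓟 (halfPlane δ)] expDecay) ∧
    ((fun z : ℍ => f2fun z * E2 z - (qfun z)⁻¹ + 24) =O[𝓟 (halfPlane δ)] expDecay) ∧
    ((fun z : ℍ => f2fun z - (qfun z)⁻¹) =O[𝓟 (halfPlane δ)] expDecay) ∧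
    ((fun z : ℍ => ModularForm.discriminant z * (qfun z)⁻¹ - 1) =O[𝓟 (halfPlane δ)] expDecay) ∧
    ((fun z : ℍ => E₄ z ^ 3 * (qfun z)⁻¹ - (qfun z)⁻¹ - 720) =O[𝓟 (halfPlane δ)] expDecay) := by
  obtain ⟨a1, a2, a3, a4, a5, a6, a7, a8⟩ := scalar24_isBigO_atImInfty
  have conv : ∀ {G : ℍ → ℂ}, Continuous G → (∀ τ : ℍ, G ((2 : ℝ) +ᵥ τ) = G τ) → G =O[atImInfty] expDecay →
      G =O[𝓟 (halfPlane δ)] expDecay := by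
    intro G hc hp hO
    have := isBigO_halfPlane_of_two_periodic hc hp 1 (hO.congr_right fun τ => (pow_one _).symm) hδ
    exact this.congr_right fun τ => pow_one _
  have pj := kleinJ_vadd_two; have p2 := E2_vadd_two; have p4 := E₄_vadd_two; have pf := f2fun_vadd_two
  have pq := qfun_inv_vadd_two; have pD := discriminant_vadd_two
  refine ⟨conv (by fun_prop) (fun τ => by simp only [pj, p4, pq]) a1, conv (by fun_prop) (fun τ => by simp only [pj, p2, pq]) a2,
    conv (by fun_prop) (fun τ => by simp only [pj, p2, pq]) a3, conv (by fun_prop) (fun τ => by simp only [pj, pq]) a4,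
    conv (by fun_prop) (fun τ => by simp only [pf, p2, pq]) a5, conv (by fun_prop) (fun τ => by simp only [pf, pq]) a6,
    conv (by fun_prop) (fun τ => by simp only [pD, pq]) a7, conv (by fun_prop) (fun τ => by simp only [p4, pq]) a8⟩

/-! ## The `z`-factors of `M_R` are `O(|z|²e^{−2π Im z})` -/

/-- The seven `z`-factors appearing in `M_R`. [cite: CohnEtAl2019, Lemma 4.9 (proof)] -/
theorem zSide24_isBigO {δ : ℝ} (hδ : 0 < δ) :
    ((fun z => K24a z - QK24a z) =O[𝓟 (halfPlane δ)] fun z : ℍ => ‖(z : ℂ)‖ ^ 2 * expDecay z) ∧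
    ((fun z => K24b z - QK24b z) =O[𝓟 (halfPlane δ)] fun z : ℍ => ‖(z : ℂ)‖ ^ 2 * expDecay z) ∧
    ((fun z => K24d z - QK24d z) =O[𝓟 (halfPlane δ)] fun z : ℍ => ‖(z : ℂ)‖ ^ 2 * expDecay z) ∧
    ((fun z => K24e z - QK24e z) =O[𝓟 (halfPlane δ)] fun z : ℍ => ‖(z : ℂ)‖ ^ 2 * expDecay z) ∧
    ((fun z => K24g z - QK24g z) =O[𝓟 (halfPlane δ)] fun z : ℍ => ‖(z : ℂ)‖ ^ 2 * expDecay z) ∧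
    ((fun z : ℍ => ((z : ℂ) - 3 * (I / π)) * (ModularForm.discriminant z * (qfun z)⁻¹ - 1)) =O[𝓟 (halfPlane δ)]
        fun z : ℍ => ‖(z : ℂ)‖ ^ 2 * expDecay z) ∧
    ((fun z : ℍ => (124416 * (I / π) * z - 435456 * (I / π) ^ 2) * (ModularForm.discriminant z * (qfun z)⁻¹ - 1)) =O[𝓟 (halfPlane δ)]
        fun z : ℍ => ‖(z : ℂ)‖ ^ 2 * expDecay z) ∧
    ((fun z : ℍ => (z : ℂ) * ModularForm.discriminant z) =O[𝓟 (halfPlane δ)] fun z : ℍ => ‖(z : ℂ)‖ ^ 2 * expDecay z) ∧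
    ((ModularForm.discriminant : ℍ → ℂ) =O[𝓟 (halfPlane δ)] fun z : ℍ => ‖(z : ℂ)‖ ^ 2 * expDecay z) ∧
    ((fun z : ℍ => ((z : ℂ) - 3 * (I / π)) * (E₄ z ^ 3 * (qfun z)⁻¹ - (qfun z)⁻¹ - 720)) =O[𝓟 (halfPlane δ)]
        fun z : ℍ => ‖(z : ℂ)‖ ^ 2 * expDecay z) ∧
    ((fun z : ℍ => (124416 * (I / π) * z - 435456 * (I / π) ^ 2) * (E₄ z ^ 3 * (qfun z)⁻¹ - (qfun z)⁻¹ - 720)) =O[𝓟 (halfPlane δ)]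
        fun z : ℍ => ‖(z : ℂ)‖ ^ 2 * expDecay z) ∧
    ((fun z : ℍ => (z : ℂ) * (E₄ z ^ 3 - 1)) =O[𝓟 (halfPlane δ)] fun z : ℍ => ‖(z : ℂ)‖ ^ 2 * expDecay z) ∧
    ((fun z : ℍ => E₄ z ^ 3 - 1) =O[𝓟 (halfPlane δ)] fun z : ℍ => ‖(z : ℂ)‖ ^ 2 * expDecay z) := by
  obtain ⟨s2, s4a, s4b, s4c, s5a, s5b, r1, r2⟩ := scalar24_isBigO_halfPlane hδ
  obtain ⟨h4, _, h2, hΔ, hE4, _, hE2, h1, hcoe, hq1⟩ := halfPlane_isBigO_basic hδ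
  obtain ⟨_, _, _, _, _, _, _, _, z43, _, _⟩ := halfPlane_isBigO_factors hδ
  set l := 𝓟 (halfPlane δ)
  -- lifting scalars by powers of `|z|`
  have up : ∀ {f : ℍ → ℂ}, f =O[l] (fun τ : ℍ => ‖(τ : ℂ)‖) → f =O[l] fun τ : ℍ => ‖(τ : ℂ)‖ ^ 2 := by
    intro f hf
    refine hf.trans ?_
    rw [isBigO_principal]
    refine ⟨1 / δ, fun τ hτ => ?_⟩
    have hτ1 : δ ≤ ‖(τ : ℂ)‖ := (mem_halfPlane.1 hτ).trans (im_le_norm_coe τ)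
    rw [norm_norm, Real.norm_of_nonneg (sq_nonneg _), sq, one_div, ← mul_assoc, inv_mul_eq_div]
    exact le_mul_of_one_le_left (norm_nonneg _) (by rw [le_div_iff₀ hδ, one_mul]; exact hτ1)
  have hone2 : (fun _ : ℍ => (1 : ℂ)) =O[l] fun z : ℍ => ‖(z : ℂ)‖ ^ 2 := up h1
  have hz2 : (fun z : ℍ => (z : ℂ)) =O[l] fun z : ℍ => ‖(z : ℂ)‖ ^ 2 := up hcoe
  have hsq : (fun z : ℍ => (z : ℂ) ^ 2) =O[l] fun z : ℍ => ‖(z : ℂ)‖ ^ 2 := by simpa [sq] using hcoe.mul hcoe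
  have lin : ∀ (a b : ℂ), (fun z : ℍ => a * (z : ℂ) + b) =O[l] fun z : ℍ => ‖(z : ℂ)‖ ^ 2 := fun a b =>
    ((hz2.const_mul_left a).add (hone2.const_mul_left b)).congr_left fun z => by ring
  have P : ∀ {u v : ℍ → ℂ}, u =O[l] (fun z : ℍ => ‖(z : ℂ)‖ ^ 2) → v =O[l] expDecay →
      (fun z => u z * v z) =O[l] fun z : ℍ => ‖(z : ℂ)‖ ^ 2 * expDecay z := fun hu hv => hu.mul hv
  -- the five `h`-remainders
  have R1 : (fun z : ℍ => E₄ z * (z : ℂ) ^ 2 - Qh24a z) =O[l] fun z : ℍ => ‖(z : ℂ)‖ ^ 2 * expDecay z :=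
    (P hsq h4).congr_left fun z => by simp only [Qh24a]; ring
  have R3 : (fun z : ℍ => phiTilde2 z - Qh24c z) =O[l] fun z : ℍ => ‖(z : ℂ)‖ ^ 2 * expDecay z := by
    have hlin : (fun z : ℍ => (z : ℂ) * E2 z + z - 12 * I / π) =O[l] fun z : ℍ => ‖(z : ℂ)‖ := by
      have a1 : (fun z : ℍ => (z : ℂ) * E2 z) =O[l] fun z : ℍ => ‖(z : ℂ)‖ := by simpa using hcoe.mul hE2
      have a2 : (fun _ : ℍ => (12 * I / π : ℂ)) =O[l] fun z : ℍ => ‖(z : ℂ)‖ := by simpa using h1.const_mul_left (12 * I / π : ℂ)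
      exact (a1.add hcoe).sub a2
    have := (hcoe.mul h2).mul hlin
    refine (this.congr_left fun z => ?_).congr_right fun z => by ring
    simp only [phiTilde2, Qh24c]; ring
  have R2 : (fun z : ℍ => kleinJ z * E₄ z * (z : ℂ) ^ 2 - Qh24b z) =O[l] fun z : ℍ => ‖(z : ℂ)‖ ^ 2 * expDecay z :=
    (P hsq s2).congr_left fun z => by simp only [Qh24b]; ring
  have R4 : (fun z : ℍ => kleinJ z * phiTilde2 z - Qh24d z) =O[l] fun z : ℍ => ‖(z : ℂ)‖ ^ 2 * expDecay z := by
    have t1 := P hsq s4a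
    have t2 := P (hz2.const_mul_left (12 * (I / π))) s4b
    have t3 := P (hone2.const_mul_left (36 * (I / π) ^ 2)) s4c
    have := (t1.sub t2).add t3
    refine this.congr_left fun z => ?_
    simp only [phiTilde2, Qh24d]; ring
  have R5 : (fun z : ℍ => f2fun z * phiTilde0 z - Qh24e z) =O[l] fun z : ℍ => ‖(z : ℂ)‖ ^ 2 * expDecay z := by
    have t1 := P hsq s5a
    have t2 := P (hz2.const_mul_left (6 * (I / π))) s5b
    have := t1.sub t2
    refine this.congr_left fun z => ?_
    simp only [phiTilde0, Qh24e]; ring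
  have w1 : (fun z : ℍ => ((z : ℂ) - 3 * (I / π)) * (ModularForm.discriminant z * (qfun z)⁻¹ - 1)) =O[l]
      fun z : ℍ => ‖(z : ℂ)‖ ^ 2 * expDecay z :=
    (P (lin 1 (-(3 * (I / π)))) r1).congr_left fun z => by ring
  have w2 : (fun z : ℍ => (124416 * (I / π) * z - 435456 * (I / π) ^ 2) * (ModularForm.discriminant z * (qfun z)⁻¹ - 1)) =O[l]
      fun z : ℍ => ‖(z : ℂ)‖ ^ 2 * expDecay z :=
    (P (lin (124416 * (I / π)) (-(435456 * (I / π) ^ 2))) r1).congr_left fun z => by ring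
  have w4 : (ModularForm.discriminant : ℍ → ℂ) =O[l] fun z : ℍ => ‖(z : ℂ)‖ ^ 2 * expDecay z :=
    (P hone2 hΔ).congr_left fun z => by simp
  have w5 : (fun z : ℍ => ((z : ℂ) - 3 * (I / π)) * (E₄ z ^ 3 * (qfun z)⁻¹ - (qfun z)⁻¹ - 720)) =O[l]
      fun z : ℍ => ‖(z : ℂ)‖ ^ 2 * expDecay z :=
    (P (lin 1 (-(3 * (I / π)))) r2).congr_left fun z => by ring
  have w6 : (fun z : ℍ => (124416 * (I / π) * z - 435456 * (I / π) ^ 2) * (E₄ z ^ 3 * (qfun z)⁻¹ - (qfun z)⁻¹ - 720)) =O[l]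
      fun z : ℍ => ‖(z : ℂ)‖ ^ 2 * expDecay z :=
    (P (lin (124416 * (I / π)) (-(435456 * (I / π) ^ 2))) r2).congr_left fun z => by ring
  refine ⟨?_, ?_, ?_, ?_, ?_, w1, w2, P hz2 hΔ, w4, w5, w6, P hz2 z43, ?_⟩
  · have := (R1.sub R3).const_mul_left 6
    exact this.congr_left fun z => by simp only [K24a, QK24a]; ring
  · have := (R3.const_mul_left 1728).add ((R4.sub R2).const_mul_left 6)
    exact this.congr_left fun z => by simp only [K24b, QK24b]; ring
  · have := ((R1.const_mul_left (5 * 1728)).sub (R3.const_mul_left (7 * 1728))).add ((R2.sub R4).const_mul_left 12)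
    exact this.congr_left fun z => by simp only [K24d, QK24d]; ring
  · have := (((R2.const_mul_left (-5)).sub (R5.const_mul_left 2)).add (R4.const_mul_left 7)).const_mul_left 1728
    exact this.congr_left fun z => by simp only [K24e, QK24e]; ring
  · have := (R1.const_mul_left 1728).add ((R4.sub R2).const_mul_left 6)
    exact this.congr_left fun z => by simp only [K24g, QK24g]; ring
  · have := P hone2 z43
    exact this.congr_left fun z => by ring

/-- **`M_R = O(|τ|²|z|²e^{−2π Im z})`** on the product of half-planes, for rows `O(|τ|²)`.
[cite: CohnEtAl2019, Lemma 4.9 (4.16)] -/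
theorem plus24M_isBigO {δ : ℝ} (hδ : 0 < δ) {Rm R0 R2 : ℍ → ℂ}
    (hm : Rm =O[𝓟 (halfPlane δ)] fun τ : ℍ => ‖(τ : ℂ)‖ ^ 2) (h0 : R0 =O[𝓟 (halfPlane δ)] fun τ : ℍ => ‖(τ : ℂ)‖ ^ 2)
    (h2 : R2 =O[𝓟 (halfPlane δ)] fun τ : ℍ => ‖(τ : ℂ)‖ ^ 2) :
    (fun p : ℍ × ℍ => plus24M Rm R0 R2 p.1 p.2) =O[𝓟 (halfPlane δ ×ˢ halfPlane δ)]
      fun p => ‖(p.1 : ℂ)‖ ^ 2 * (‖(p.2 : ℂ)‖ ^ 2 * expDecay p.2) := by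
  obtain ⟨_, _, _, hΔ, hE4, hE6, _, _, _, hq1⟩ := halfPlane_isBigO_basic hδ
  obtain ⟨ka, kb, kd, ke, kg, w1, w2, w3, w4, w5, w6, w7, w8⟩ := zSide24_isBigO hδ
  set F := 𝓟 (halfPlane δ ×ˢ halfPlane δ)
  set l := 𝓟 (halfPlane δ)
  have bb : ∀ {u v : ℍ → ℂ}, u =O[l] (fun _ : ℍ => (1 : ℝ)) → v =O[l] (fun _ : ℍ => (1 : ℝ)) →
      (fun τ => u τ * v τ) =O[l] fun _ : ℍ => (1 : ℝ) := fun hu hv => by simpa using hu.mul hv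
  have hΔ1 : (ModularForm.discriminant : ℍ → ℂ) =O[l] fun _ : ℍ => (1 : ℝ) := hΔ.trans hq1
  have hE4_2 : (fun τ : ℍ => E₄ τ ^ 2) =O[l] fun _ : ℍ => (1 : ℝ) := by simpa [sq] using bb hE4 hE4
  have hE4_3 : (fun τ : ℍ => E₄ τ ^ 3) =O[l] fun _ : ℍ => (1 : ℝ) := by simpa [pow_succ] using bb hE4_2 hE4
  have hE4_6 : (fun τ : ℍ => E₄ τ ^ 6) =O[l] fun _ : ℍ => (1 : ℝ) := by simpa [← pow_add] using bb hE4_3 hE4_3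
  have hE14 : E14fun =O[l] fun _ : ℍ => (1 : ℝ) := (bb (bb hE4 hE4) hE6).congr_left fun τ => by simp [E14fun]
  have hE10 : E10fun =O[l] fun _ : ℍ => (1 : ℝ) := (bb hE4 hE6).congr_left fun τ => by simp [E10fun]
  have hΔ2 : (fun τ : ℍ => ModularForm.discriminant τ ^ 2) =O[l] fun _ : ℍ => (1 : ℝ) := by simpa [sq] using bb hΔ1 hΔ1
  -- rows × bounded
  have RB : ∀ {R u : ℍ → ℂ}, R =O[l] (fun τ : ℍ => ‖(τ : ℂ)‖ ^ 2) → u =O[l] (fun _ : ℍ => (1 : ℝ)) →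
      (fun τ => R τ * u τ) =O[l] fun τ : ℍ => ‖(τ : ℂ)‖ ^ 2 := fun hR hu => by simpa using hR.mul hu
  -- the `τ`-coefficients of `Ĝ₋₁`, `Ĝ₀`
  have A1 : (fun τ => Rm τ * E₄ τ ^ 2 * E₆ τ - 2 * R0 τ * E₄ τ ^ 3 + R2 τ * E₄ τ * E₆ τ) =O[l] fun τ : ℍ => ‖(τ : ℂ)‖ ^ 2 := by
    have t1 := RB hm (bb hE4_2 hE6)
    have t2 := (RB h0 hE4_3).const_mul_left 2
    have t3 := RB h2 (bb hE4 hE6)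
    exact ((t1.sub t2).add t3).congr_left fun τ => by ring
  have T : ∀ {a g : ℍ → ℂ}, a =O[l] (fun τ : ℍ => ‖(τ : ℂ)‖ ^ 2) →
      g =O[l] (fun z : ℍ => ‖(z : ℂ)‖ ^ 2 * expDecay z) →
      (fun p : ℍ × ℍ => a p.1 * g p.2) =O[F] fun p => ‖(p.1 : ℂ)‖ ^ 2 * (‖(p.2 : ℂ)‖ ^ 2 * expDecay p.2) :=
    fun ha hg => (isBigO_fst_of_halfPlane ha).mul (isBigO_snd_of_halfPlane hg)
  -- the seven `f`-terms
  have s1 := T (RB (RB hm hE14) hE4_3) ka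
  have s2 := T (RB (RB hm hE14) hΔ1) kb
  have s3 := T (RB h0 hE4_6) (ka.const_mul_left (-2))
  have s4 := T (RB (RB h0 hE4_3) hΔ1) kd
  have s5 := T (RB h0 hΔ2) ke
  have s6 := T (RB (RB h2 hE10) hE4_3) ka
  have s7 := T (RB (RB h2 hE10) hΔ1) kg
  -- the `Ĝ`-terms
  have g1 := T ((RB A1 hE4_3).const_mul_left (72 * (I / π))) w1
  have g2 := T (RB (RB h0 hΔ1) hE4_3) w2
  have g5 := T ((RB A1 hΔ1).const_mul_left (72 * (I / π))) w5
  have g6 := T (RB (RB h0 hΔ1) hΔ1) w6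
  -- `Ĝ₀ = z·B(τ) + C(τ)`
  have t1 : (fun τ => Rm τ * (E₄ τ ^ 2 * E₆ τ)) =O[l] fun τ : ℍ => ‖(τ : ℂ)‖ ^ 2 := RB hm (bb hE4_2 hE6)
  have t2 : (fun τ => R0 τ * E₄ τ ^ 3) =O[l] fun τ : ℍ => ‖(τ : ℂ)‖ ^ 2 := RB h0 hE4_3
  have t3 : (fun τ => R0 τ * ModularForm.discriminant τ) =O[l] fun τ : ℍ => ‖(τ : ℂ)‖ ^ 2 := RB h0 hΔ1
  have t4 : (fun τ => R2 τ * (E₄ τ * E₆ τ)) =O[l] fun τ : ℍ => ‖(τ : ℂ)‖ ^ 2 := RB h2 (bb hE4 hE6)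
  have B1 : (fun τ => 20736 * (I / π) * (Rm τ * E₄ τ ^ 2 * E₆ τ) - 20736 * (I / π) * (R0 τ * E₄ τ ^ 3)
      + 14929920 * (I / π) * (R0 τ * ModularForm.discriminant τ)) =O[l] fun τ : ℍ => ‖(τ : ℂ)‖ ^ 2 :=
    (((t1.const_mul_left (20736 * (I / π))).sub (t2.const_mul_left (20736 * (I / π)))).add
      (t3.const_mul_left (14929920 * (I / π)))).congr_left fun τ => by ring
  have C1 : (fun τ => -(67392 * (I / π) ^ 2 * (Rm τ * E₄ τ ^ 2 * E₆ τ)) + 10368 * (I / π) ^ 2 * (R0 τ * E₄ τ ^ 3)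
      - 10450944 * (I / π) ^ 2 * (R0 τ * ModularForm.discriminant τ) - 5184 * (I / π) ^ 2 * (R2 τ * E₄ τ * E₆ τ)) =O[l]
      fun τ : ℍ => ‖(τ : ℂ)‖ ^ 2 :=
    ((((t1.const_mul_left (67392 * (I / π) ^ 2)).neg_left.add (t2.const_mul_left (10368 * (I / π) ^ 2))).sub
      (t3.const_mul_left (10450944 * (I / π) ^ 2))).sub (t4.const_mul_left (5184 * (I / π) ^ 2))).congr_left fun τ => by ring
  have g3 := T (RB B1 hE4_3) w3
  have g4 := T (RB C1 hE4_3) w4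
  have g7 := T (RB B1 hΔ1) w7
  have g8 := T (RB C1 hΔ1) w8
  have total := ((((((s1.add s2).add s3).add s4).add s5).add s6).add s7).sub
    (((((g1.add g2).add (g3.add g4)).sub (g5.add g6)).sub (g7.add g8)))
  refine total.congr_left fun p => ?_
  simp only [plus24M, plus24GhatM1, plus24Ghat0]
  ring

/-- Conversion to the printed shape. [folklore] -/
theorem plus24Kernel_sub_G_bound_of_isBigO {δ : ℝ} {Rm R0 R2 : ℍ → ℂ} {w : ℍ × ℍ → ℝ} (hw : ∀ p, 0 ≤ w p)
    (hO : (fun p : ℍ × ℍ => plus24M Rm R0 R2 p.1 p.2) =O[𝓟 (halfPlane δ ×ˢ halfPlane δ)] w) :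
    ∃ C : ℝ, ∀ τ z : ℍ, δ ≤ τ.im → δ ≤ z.im →
      ‖(plus24Kernel Rm R0 R2 τ z - plus24G Rm R0 R2 τ z) *
        (ModularForm.discriminant τ * ModularForm.discriminant z * (kleinJ τ - kleinJ z))‖ ≤ C * w (τ, z) := by
  obtain ⟨C, hC⟩ := isBigO_principal.1 hO
  refine ⟨‖(π : ℂ) ^ 2 / (36 * 1728 * I)‖ * |C|, fun τ z hτ hz => (norm_plus24Kernel_sub_G_mul_le Rm R0 R2 τ z).trans ?_⟩
  have h := hC (τ, z) ⟨hτ, hz⟩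
  rw [Real.norm_of_nonneg (hw _)] at h
  have h2 : ‖plus24M Rm R0 R2 τ z‖ ≤ |C| * w (τ, z) := h.trans (mul_le_mul_of_nonneg_right (le_abs_self C) (hw _))
  calc _ ≤ ‖(π : ℂ) ^ 2 / (36 * 1728 * I)‖ * (|C| * w (τ, z)) := mul_le_mul_of_nonneg_left h2 (norm_nonneg _)
    _ = _ := by ring

/-- **Lemma 4.9 (4.16) for `𝒦₊^{(24)}|₁₂γ`, `γ ∈ {I, T, TS}`** (multiplied-out; the rows of `(𝒦 − 𝒢)|γ` are
`φ|γ`, `𝒢 = plus24G (φ₋₂|γ) (φ₀|γ) (φ₂|γ)`): on `Im τ, Im z ≥ δ`,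
`‖((𝒦₊^{(24)}|₁₂γ)(τ,z) − 𝒢(τ,z))·Δ(τ)Δ(z)(j(τ)−j(z))‖ ≤ C|τ|²|z|²e^{−2π Im z}`.
[cite: CohnEtAl2019, Lemma 4.9 (4.16)] -/
theorem kernelPlus24_sub_G_bound_416 {δ : ℝ} (hδ : 0 < δ) (γ : SL(2, ℤ))
    (hγ : γ = 1 ∨ γ = ModularGroup.T ∨ γ = ModularGroup.T * ModularGroup.S) :
    ∃ C : ℝ, ∀ τ z : ℍ, δ ≤ τ.im → δ ≤ z.im →
      ‖(((fun σ => kernelPlus24 σ z) ∣[(12 : ℤ)] γ) τ -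
          plus24G (phiNeg2 ∣[(-2 : ℤ)] γ) (phi0 ∣[(0 : ℤ)] γ) (phi2 ∣[(2 : ℤ)] γ) τ z) *
        (ModularForm.discriminant τ * ModularForm.discriminant z * (kleinJ τ - kleinJ z))‖
          ≤ C * (‖(τ : ℂ)‖ ^ 2 * ‖(z : ℂ)‖ ^ 2 * expDecay z) := by
  obtain ⟨r1, r2, r3, r4, r5, r6⟩ := rows_isBigO_sq hδ
  obtain ⟨hφm, hφ0, hφ2⟩ := halfPlane_isBigO_phi hδ
  have up : ∀ {f : ℍ → ℂ}, f =O[𝓟 (halfPlane δ)] (fun τ : ℍ => ‖(τ : ℂ)‖) → f =O[𝓟 (halfPlane δ)] fun τ : ℍ => ‖(τ : ℂ)‖ ^ 2 := by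
    intro f hf
    refine hf.trans ?_
    rw [isBigO_principal]
    refine ⟨1 / δ, fun τ hτ => ?_⟩
    have hτ1 : δ ≤ ‖(τ : ℂ)‖ := (mem_halfPlane.1 hτ).trans (im_le_norm_coe τ)
    rw [norm_norm, Real.norm_of_nonneg (sq_nonneg _), sq, one_div, ← mul_assoc, inv_mul_eq_div]
    exact le_mul_of_one_le_left (norm_nonneg _) (by rw [le_div_iff₀ hδ, one_mul]; exact hτ1)
  have main : ∀ {Rm R0 R2 : ℍ → ℂ}, phiNeg2 ∣[(-2 : ℤ)] γ = Rm → phi0 ∣[(0 : ℤ)] γ = R0 → phi2 ∣[(2 : ℤ)] γ = R2 →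
      Rm =O[𝓟 (halfPlane δ)] (fun τ : ℍ => ‖(τ : ℂ)‖ ^ 2) → R0 =O[𝓟 (halfPlane δ)] (fun τ : ℍ => ‖(τ : ℂ)‖ ^ 2) →
      R2 =O[𝓟 (halfPlane δ)] (fun τ : ℍ => ‖(τ : ℂ)‖ ^ 2) →
      ∃ C : ℝ, ∀ τ z : ℍ, δ ≤ τ.im → δ ≤ z.im →
        ‖(((fun σ => kernelPlus24 σ z) ∣[(12 : ℤ)] γ) τ -
            plus24G (phiNeg2 ∣[(-2 : ℤ)] γ) (phi0 ∣[(0 : ℤ)] γ) (phi2 ∣[(2 : ℤ)] γ) τ z) *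
          (ModularForm.discriminant τ * ModularForm.discriminant z * (kleinJ τ - kleinJ z))‖
            ≤ C * (‖(τ : ℂ)‖ ^ 2 * ‖(z : ℂ)‖ ^ 2 * expDecay z) := by
    intro Rm R0 R2 e1 e2 e3 hm h0 h2
    have hw : ∀ p : ℍ × ℍ, 0 ≤ ‖(p.1 : ℂ)‖ ^ 2 * (‖(p.2 : ℂ)‖ ^ 2 * expDecay p.2) := fun p =>
      mul_nonneg (sq_nonneg _) (mul_nonneg (sq_nonneg _) (expDecay_pos _).le)
    obtain ⟨C, hC⟩ := plus24Kernel_sub_G_bound_of_isBigO hw (plus24M_isBigO hδ hm h0 h2)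
    refine ⟨C, fun τ z hτ hz => ?_⟩
    have h := hC τ z hτ hz
    rw [kernelPlus24_eq_plus24Kernel, plus24Kernel_slash, e1, e2, e3]
    simpa [mul_assoc] using h
  rcases hγ with rfl | rfl | rfl
  · exact main (by rw [SlashAction.slash_one]) (by rw [SlashAction.slash_one]) (by rw [SlashAction.slash_one])
      (up hφm) (up hφ0) (up hφ2)
  · obtain ⟨hT1, hT2, hT3⟩ := phi_rows_slash_T
    exact main hT1 hT2 hT3 r1 r2 r3
  · obtain ⟨hS1, hS2, hS3⟩ := phi_rows_slash_TS
    exact main hS1 hS2 hS3 r4 r5 r6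

end Literature.NumberTheory.ModularForms
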